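import Mathlib
import Literature.Probability.LatticeModels.ThermodynamicLimit
import Literature.Probability.LatticeModels.SharpnessProofs
import HarnessLib

/-!
# Tightness of the rescaled jump measures — auxiliary file for stub `stub_tightness` of line
# `diffusive-branch-is-nonsaturation` (crux `PrecisionLaplacian.DirectCorrelationStableTail`,
# stmt-CriticalPhenomena-4799): tightness at infinity (flux identity) and a 1-D power sum

Notation: `B_ρ = box 3 ρ = {−ρ,…,ρ}³ ⊆ ℤ³ = Site 3`, `‖·‖` the sup norm (`Site.norm_eq_supNorm`),
`F_ρ(w) = Σ_{z ∈ B_ρ} G(z + w)`.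

**Main result (`tight_atInfinity`, registered as the sub-goal `stub_tightness_auxAtInfinity`).**
Let `m ∈ ℓ¹(ℤ³)`, `Σ m = 0`, `m ≥ 0` off `0`, and let `G ≥ 0` satisfy the precision identity
`Σ_y m(y) G(z − y) = −δ_{z0}`, box capture `Σ_{z∈B_R} G(z + v) ≤ Σ_{z∈B_R} G(z)` and the scale
bounds `G(x) ≤ C₁‖x‖^{α−3}` (`x ≠ 0`), `c₁‖x‖^{α−3} ≤ G(x)` (`‖x‖ ≥ R₀`), `0 ≤ α ≤ 2`, `c₁ > 0`.
Then there are `C ≥ 0`, `R₁ ≥ 1` with `R^α Σ_{y ∈ T} m(y) ≤ C` for all `R ≥ R₁` and all finite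
`T ⊆ {‖y‖ ≥ R}` (the rescaled jump measures `R^α Σ_x m(x) δ_{x/R}` have bounded mass off the unit
ball).

**Proof.** `tight_flux` (template: the landed `nonSatHeavyTail_flux`, there for
`G = criticalTwoPoint 3`): `G` is bounded (`‖x‖ ≥ 1` off `0`), summing the precision identity over
`z ∈ B_ρ` and using `Σ m = 0` gives `Σ_y m(y)(F_ρ(0) − F_ρ(−y)) = 1` with nonnegative terms (box
capture, `m ≥ 0` off `0`), so finite partial sums are `≤ 1`.  `tight_lower`: for `ρ ≥ 2R₀ + 1` the
shell `B_ρ ∖ B_{R₀}` has `≥ 7ρ³` sites with `G ≥ c₁ρ^{α−3}`, so `F_ρ(0) ≥ 7c₁ρ^α`.  `tight_far`: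
for `‖y‖ ≥ Kρ`, `K ≥ 2`, every `z ∈ B_ρ` has `‖z − y‖ ≥ (K−1)ρ`, so
`F_ρ(−y) ≤ 27C₁(K−1)^{α−3}ρ^α ≤ 6c₁ρ^α` once `27C₁ ≤ 6c₁(K−1)` (`(K−1)^{α−3} ≤ (K−1)^{−1}`).
Hence `c₁ρ^α Σ_T m ≤ 1` for finite `T ⊆ {‖y‖ ≥ Kρ}`; for `R ≥ R₁ := K(2R₀+1)` take `ρ := ⌊R/K⌋`,
so `Kρ ≤ R ≤ 2Kρ` and `R^α Σ_T m ≤ (2K)^α/c₁`.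

Also: `Σ_{t=−R}^{R} |t|^{1−α} ≤ 2R^{2−α}/(2−α)` for `1 < α < 2` (`tight_sum_Icc_abs_rpow`), by
telescoping with Bernoulli's inequality `(2−α)(s+1)^{1−α} ≤ (s+1)^{2−α} − s^{2−α}`
(`tight_rpow_step`); used by the main file for the truncated second moment.

Pure theorem file, no definitions, no `sorry`.  References: the flux/box-capture mechanism is that
of A. Messager, S. Miracle-Solé, J. Stat. Phys. 17 (1977) 245 (box capture is a hypothesis here);
everything proved in this file is elementary [folklore].
-/

noncomputable section

namespace Summit.CriticalPhenomena.Ising3DConformalLimit.Cruxes.DirectCorrelationStableTail.DiffusiveBranchIsNonsaturation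

open Filter Topology
open scoped BigOperators
open Literature.Probability.LatticeModels

/-! ### Elementary facts -/

/-- `ρ³ · ρ^{α-3} = ρ^α` for `ρ > 0`. [folklore] -/
theorem tight_pow_three_mul_rpow {ρ : ℝ} (hρ : 0 < ρ) (α : ℝ) :
    ρ ^ 3 * ρ ^ (α - 3) = ρ ^ α := by
  rw [← Real.rpow_natCast ρ 3, ← Real.rpow_add hρ]
  norm_num

/-- A kernel with `0 ≤ G`, `G(x) ≤ C₁‖x‖^{α-3}` off `0` (`α ≤ 3`) is bounded by
`max (G 0) |C₁|`. [folklore] -/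
theorem tight_G_le {G : Site 3 → ℝ} {α C₁ : ℝ} (hα3 : α - 3 ≤ 0)
    (hup : ∀ x : Site 3, x ≠ 0 → G x ≤ C₁ * ‖x‖ ^ (α - 3)) (x : Site 3) :
    G x ≤ max (G 0) |C₁| := by
  by_cases hx : x = 0
  · subst hx
    exact le_max_left _ _
  · have h1 : (1 : ℝ) ≤ ‖x‖ := by
      -- a nonzero lattice point has integer sup norm `≥ 1`
      -- (cf. `GapForcesFarMerging.Negative.one_le_norm_of_ne_zero`, not imported: foreign route)
      rw [Site.norm_eq_supNorm]
      exact_mod_cast Nat.one_le_iff_ne_zero.2 fun h => hx (Site.supNorm_eq_zero_iff.1 h)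
    have hr0 : 0 ≤ ‖x‖ ^ (α - 3) := Real.rpow_nonneg (norm_nonneg _) _
    have hr1 : ‖x‖ ^ (α - 3) ≤ 1 := Real.rpow_le_one_of_one_le_of_nonpos h1 hα3
    calc G x ≤ C₁ * ‖x‖ ^ (α - 3) := hup x hx
      _ ≤ |C₁| * ‖x‖ ^ (α - 3) := mul_le_mul_of_nonneg_right (le_abs_self C₁) hr0
      _ ≤ |C₁| := mul_le_of_le_one_right (abs_nonneg _) hr1
      _ ≤ max (G 0) |C₁| := le_max_right _ _

/-- Summability of `y ↦ m(y) G(z − y)` for `m ∈ ℓ¹(ℤ³)` and `0 ≤ G ≤ M`. [folklore] -/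
theorem tight_summable_mul {m G : Site 3 → ℝ} (hm : Summable m) {M : ℝ} (hG0 : ∀ x, 0 ≤ G x)
    (hGM : ∀ x, G x ≤ M) (z : Site 3) : Summable (fun y => m y * G (z - y)) := by
  refine Summable.of_norm_bounded (hm.norm.mul_right M) fun y => ?_
  rw [norm_mul, Real.norm_of_nonneg (hG0 _)]
  exact mul_le_mul_of_nonneg_left (hGM _) (norm_nonneg _)

/-! ### The flux bound -/

/-- **Flux bound.** For `m ∈ ℓ¹(ℤ³)` with `Σ m = 0`, `m ≥ 0` off `0`, the precision identity
`Σ_y m(y) G(z − y) = −δ_{z0}` and box capture, every finite partial sum of the nonnegative series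
`Σ_y m(y) (F_R(0) − F_R(−y)) = 1`, `F_R(w) = Σ_{z ∈ B_R} G(z + w)`, is at most `1`. [folklore] -/
theorem tight_flux {m G : Site 3 → ℝ} (hm : Summable m) (hzero : (∑' y, m y) = 0)
    (hnn : ∀ y, y ≠ 0 → 0 ≤ m y)
    (hconv : ∀ z : Site 3, (∑' y, m y * G (z - y)) = if z = 0 then -1 else 0)
    (hcap : ∀ (R : ℕ) (v : Site 3), ∑ z ∈ box 3 R, G (z + v) ≤ ∑ z ∈ box 3 R, G z)
    (hsm : ∀ z : Site 3, Summable (fun y => m y * G (z - y)))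
    (R : ℕ) (T : Finset (Site 3)) :
    ∑ y ∈ T, m y * (∑ z ∈ box 3 R, G z - ∑ z ∈ box 3 R, G (z - y)) ≤ 1 := by
  -- adapted from `nonSatHeavyTail_flux` (same namespace, `G = criticalTwoPoint 3` there)
  classical
  have hs1 : Summable fun y => m y * ∑ z ∈ box 3 R, G z := hm.mul_right _
  have hs2 : Summable fun y => ∑ z ∈ box 3 R, m y * G (z - y) :=
    summable_sum fun z _ => hsm z
  have hpt : ∀ y, m y * (∑ z ∈ box 3 R, G z - ∑ z ∈ box 3 R, G (z - y)) =
      m y * ∑ z ∈ box 3 R, G z - ∑ z ∈ box 3 R, m y * G (z - y) :=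
    fun y => by rw [mul_sub, sub_right_inj, Finset.mul_sum]
  have hs : Summable fun y => m y * (∑ z ∈ box 3 R, G z - ∑ z ∈ box 3 R, G (z - y)) := by
    simp_rw [hpt]
    exact hs1.sub hs2
  have hval : ∑' y, m y * (∑ z ∈ box 3 R, G z - ∑ z ∈ box 3 R, G (z - y)) = 1 := by
    simp_rw [hpt]
    rw [hs1.tsum_sub hs2, tsum_mul_right, hzero, zero_mul,
      Summable.tsum_finsetSum fun z _ => hsm z]
    simp_rw [hconv]
    simp [Finset.sum_ite_eq']
  have h0 : ∀ y, 0 ≤ m y * (∑ z ∈ box 3 R, G z - ∑ z ∈ box 3 R, G (z - y)) := by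
    intro y
    by_cases hy : y = 0
    · subst hy
      simp
    · refine mul_nonneg (hnn y hy) (sub_nonneg.2 ?_)
      have h := hcap R (-y)
      simp_rw [← sub_eq_add_neg] at h
      exact h
  calc ∑ y ∈ T, m y * (∑ z ∈ box 3 R, G z - ∑ z ∈ box 3 R, G (z - y))
      ≤ ∑' y, m y * (∑ z ∈ box 3 R, G z - ∑ z ∈ box 3 R, G (z - y)) :=
        hs.sum_le_tsum T fun y _ => h0 y
    _ = 1 := hval

/-- **Box mass from the lower scale bound.** If `c₁‖z‖^{α−3} ≤ G(z)` for `‖z‖ ≥ R₀` (`α ≤ 3`,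
`c₁ ≥ 0`, `G ≥ 0`), then `7 c₁ ρ^α ≤ Σ_{z ∈ B_ρ} G(z)` for `ρ ≥ 2R₀ + 1`: the shell `B_ρ ∖ B_{R₀}`
has at least `7ρ³` sites, each carrying `G ≥ c₁ ρ^{α−3}`. [folklore] -/
theorem tight_lower {G : Site 3 → ℝ} {α c₁ : ℝ} {R₀ : ℕ} (hG0 : ∀ x, 0 ≤ G x) (hα3 : α - 3 ≤ 0)
    (hc₁ : 0 ≤ c₁) (hlo : ∀ x : Site 3, (R₀ : ℝ) ≤ ‖x‖ → c₁ * ‖x‖ ^ (α - 3) ≤ G x)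
    {ρ : ℕ} (hρ : 2 * R₀ + 1 ≤ ρ) :
    7 * c₁ * (ρ : ℝ) ^ α ≤ ∑ z ∈ box 3 ρ, G z := by
  have hρpos : (0 : ℝ) < ρ := by exact_mod_cast (show 0 < ρ by omega)
  have hR₀ρ : R₀ ≤ ρ := by omega
  -- pointwise on the shell
  have hpt : ∀ z ∈ box 3 ρ \ box 3 R₀, c₁ * (ρ : ℝ) ^ (α - 3) ≤ G z := by
    intro z hz
    rw [Finset.mem_sdiff, mem_box_iff_supNorm_le, mem_box_iff_supNorm_le] at hz
    have h1 : (R₀ : ℝ) ≤ ‖z‖ := by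
      rw [Site.norm_eq_supNorm]
      exact_mod_cast (show R₀ ≤ Site.supNorm z by omega)
    have h2 : 0 < ‖z‖ := by
      rw [Site.norm_eq_supNorm]
      exact_mod_cast (show 0 < Site.supNorm z by omega)
    have h3 : ‖z‖ ≤ ρ := by
      rw [Site.norm_eq_supNorm]
      exact_mod_cast hz.1
    have h4 : (ρ : ℝ) ^ (α - 3) ≤ ‖z‖ ^ (α - 3) := Real.rpow_le_rpow_of_nonpos h2 h3 hα3
    exact (mul_le_mul_of_nonneg_left h4 hc₁).trans (hlo z h1)
  -- the shell is large (adapted from `nonSatHeavyTail_lower`)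
  have hcard : 7 * (ρ : ℝ) ^ 3 ≤ ((box 3 ρ \ box 3 R₀).card : ℝ) := by
    have h1 : (box 3 ρ \ box 3 R₀).card + (2 * R₀ + 1) ^ 3 = (2 * ρ + 1) ^ 3 := by
      rw [← card_box 3 R₀, ← card_box 3 ρ]
      exact Finset.card_sdiff_add_card_eq_card (box_mono 3 hR₀ρ)
    have h2 : ((box 3 ρ \ box 3 R₀).card : ℝ) + (2 * (R₀ : ℝ) + 1) ^ 3 = (2 * (ρ : ℝ) + 1) ^ 3 := by
      exact_mod_cast h1
    have h3 : (2 * (R₀ : ℝ) + 1) ≤ ρ := by exact_mod_cast hρ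
    have h4 : (2 * (R₀ : ℝ) + 1) ^ 3 ≤ (ρ : ℝ) ^ 3 := pow_le_pow_left₀ (by positivity) h3 3
    nlinarith [h2, h4, hρpos.le, sq_nonneg (ρ : ℝ)]
  have hr0 : 0 ≤ c₁ * (ρ : ℝ) ^ (α - 3) := mul_nonneg hc₁ (Real.rpow_nonneg hρpos.le _)
  calc 7 * c₁ * (ρ : ℝ) ^ α = 7 * (ρ : ℝ) ^ 3 * (c₁ * (ρ : ℝ) ^ (α - 3)) := by
        rw [← tight_pow_three_mul_rpow hρpos α]; ring
    _ ≤ ((box 3 ρ \ box 3 R₀).card : ℝ) * (c₁ * (ρ : ℝ) ^ (α - 3)) :=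
        mul_le_mul_of_nonneg_right hcard hr0
    _ = ∑ _z ∈ box 3 ρ \ box 3 R₀, c₁ * (ρ : ℝ) ^ (α - 3) := by
        rw [Finset.sum_const, nsmul_eq_mul]
    _ ≤ ∑ z ∈ box 3 ρ \ box 3 R₀, G z := Finset.sum_le_sum hpt
    _ ≤ ∑ z ∈ box 3 ρ, G z :=
        Finset.sum_le_sum_of_subset_of_nonneg Finset.sdiff_subset fun z _ _ => hG0 z

/-- **Far-field bound.** If `G(x) ≤ C₁‖x‖^{α−3}` off `0` (`C₁ ≥ 0`, `α ≤ 3`), then for `ρ ≥ 1`,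
`K ≥ 2` and `‖y‖ ≥ Kρ`: `Σ_{z ∈ B_ρ} G(z − y) ≤ 27 C₁ (K−1)^{α−3} ρ^α` (each `z − y` has
`‖z − y‖ ≥ (K−1)ρ`, and `|B_ρ| ≤ 27ρ³`). [folklore] -/
theorem tight_far {G : Site 3 → ℝ} {α C₁ : ℝ} (hα3 : α - 3 ≤ 0) (hC₁ : 0 ≤ C₁)
    (hup : ∀ x : Site 3, x ≠ 0 → G x ≤ C₁ * ‖x‖ ^ (α - 3))
    {ρ K : ℕ} (hρ : 1 ≤ ρ) (hK : 2 ≤ K) {y : Site 3} (hy : (K : ℝ) * ρ ≤ ‖y‖) :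
    ∑ z ∈ box 3 ρ, G (z - y) ≤ 27 * C₁ * ((K : ℝ) - 1) ^ (α - 3) * (ρ : ℝ) ^ α := by
  have hρpos : (0 : ℝ) < ρ := by exact_mod_cast hρ
  have hρ1 : (1 : ℝ) ≤ ρ := by exact_mod_cast hρ
  have hK2 : (2 : ℝ) ≤ K := by exact_mod_cast hK
  have hK1 : (1 : ℝ) ≤ (K : ℝ) - 1 := by linarith
  have hKρ : 0 < ((K : ℝ) - 1) * ρ := mul_pos (by linarith) hρpos
  have hpt : ∀ z ∈ box 3 ρ, G (z - y) ≤ C₁ * (((K : ℝ) - 1) * ρ) ^ (α - 3) := by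
    intro z hz
    rw [mem_box_iff_supNorm_le] at hz
    have hz' : ‖z‖ ≤ ρ := by
      rw [Site.norm_eq_supNorm]
      exact_mod_cast hz
    have htri : ‖y‖ ≤ ‖z - y‖ + ‖z‖ := by
      have h := norm_sub_le (z - y) z
      rwa [sub_sub_cancel_left, norm_neg] at h
    have hge' : ((K : ℝ) - 1) * ρ ≤ ‖z - y‖ := by nlinarith
    have hne : z - y ≠ 0 := by
      have h1 : (1 : ℝ) ≤ ((K : ℝ) - 1) * ρ := by nlinarith
      exact norm_pos_iff.1 (by linarith)
    have h4 : ‖z - y‖ ^ (α - 3) ≤ (((K : ℝ) - 1) * ρ) ^ (α - 3) :=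
      Real.rpow_le_rpow_of_nonpos hKρ hge' hα3
    exact (hup (z - y) hne).trans (mul_le_mul_of_nonneg_left h4 hC₁)
  have hcard : ((box 3 ρ).card : ℝ) ≤ 27 * (ρ : ℝ) ^ 3 := by
    rw [card_box]
    push_cast
    have h1 : (1 : ℝ) ≤ ρ := by exact_mod_cast hρ
    have h2 : (2 * (ρ : ℝ) + 1) ≤ 3 * ρ := by linarith
    calc (2 * (ρ : ℝ) + 1) ^ 3 ≤ (3 * (ρ : ℝ)) ^ 3 := pow_le_pow_left₀ (by positivity) h2 3
      _ = 27 * (ρ : ℝ) ^ 3 := by ring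
  have hr0 : 0 ≤ C₁ * (((K : ℝ) - 1) * ρ) ^ (α - 3) := mul_nonneg hC₁ (Real.rpow_nonneg hKρ.le _)
  calc ∑ z ∈ box 3 ρ, G (z - y) ≤ ∑ _z ∈ box 3 ρ, C₁ * (((K : ℝ) - 1) * ρ) ^ (α - 3) :=
        Finset.sum_le_sum hpt
    _ = ((box 3 ρ).card : ℝ) * (C₁ * (((K : ℝ) - 1) * ρ) ^ (α - 3)) := by
        rw [Finset.sum_const, nsmul_eq_mul]
    _ ≤ 27 * (ρ : ℝ) ^ 3 * (C₁ * (((K : ℝ) - 1) * ρ) ^ (α - 3)) :=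
        mul_le_mul_of_nonneg_right hcard hr0
    _ = 27 * C₁ * ((K : ℝ) - 1) ^ (α - 3) * ((ρ : ℝ) ^ 3 * (ρ : ℝ) ^ (α - 3)) := by
        rw [Real.mul_rpow (by linarith) hρpos.le]; ring
    _ = 27 * C₁ * ((K : ℝ) - 1) ^ (α - 3) * (ρ : ℝ) ^ α := by
        rw [tight_pow_three_mul_rpow hρpos α]

/-- **Tightness at infinity (mass far out).**  Under the flux hypotheses, `G ≥ 0`, `0 ≤ α ≤ 2`, and
the scale bounds `G(x) ≤ C₁‖x‖^{α−3}` (`x ≠ 0`), `c₁‖x‖^{α−3} ≤ G(x)` (`‖x‖ ≥ R₀`), there are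
`C ≥ 0` and `R₁ ≥ 1` with `R^α Σ_{y ∈ T} m(y) ≤ C` for every `R ≥ R₁` and every finite
`T ⊆ {‖y‖ ≥ R}`.  Proof: with `ρ = ⌊R/K⌋`, the flux bound `Σ_T m(y)(F_ρ(0) − F_ρ(−y)) ≤ 1`, the
lower bound `F_ρ(0) ≥ 7c₁ρ^α` and the far-field bound `F_ρ(−y) ≤ 27C₁(K−1)^{α−3}ρ^α ≤ 6c₁ρ^α`
(`K` large) give `c₁ ρ^α Σ_T m ≤ 1`, and `R ≤ 2Kρ`. [folklore] -/
theorem tight_atInfinity {m G : Site 3 → ℝ} {α c₁ C₁ : ℝ} {R₀ : ℕ}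
    (hm : Summable m) (hzero : (∑' y, m y) = 0) (hnn : ∀ y, y ≠ 0 → 0 ≤ m y)
    (hconv : ∀ z : Site 3, (∑' y, m y * G (z - y)) = if z = 0 then -1 else 0)
    (hcap : ∀ (R : ℕ) (v : Site 3), ∑ z ∈ box 3 R, G (z + v) ≤ ∑ z ∈ box 3 R, G z)
    (hG0 : ∀ x, 0 ≤ G x) (hα0 : 0 ≤ α) (hα2 : α ≤ 2) (hc₁ : 0 < c₁)
    (hup : ∀ x : Site 3, x ≠ 0 → G x ≤ C₁ * ‖x‖ ^ (α - 3))
    (hlo : ∀ x : Site 3, (R₀ : ℝ) ≤ ‖x‖ → c₁ * ‖x‖ ^ (α - 3) ≤ G x) :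
    ∃ (C : ℝ) (R₁ : ℕ), 0 ≤ C ∧ 1 ≤ R₁ ∧
      ∀ R : ℕ, R₁ ≤ R → ∀ T : Finset (Site 3), (∀ y ∈ T, (R : ℝ) ≤ ‖y‖) →
        (R : ℝ) ^ α * ∑ y ∈ T, m y ≤ C := by
  have hα3 : α - 3 ≤ 0 := by linarith
  -- a nonnegative version of the upper constant
  have hC₁'0 : 0 ≤ max C₁ 0 := le_max_right _ _
  have hup' : ∀ x : Site 3, x ≠ 0 → G x ≤ max C₁ 0 * ‖x‖ ^ (α - 3) := fun x hx =>
    (hup x hx).trans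
      (mul_le_mul_of_nonneg_right (le_max_left _ _) (Real.rpow_nonneg (norm_nonneg _) _))
  -- summability of the convolution terms (`G` is bounded)
  have hsm : ∀ z : Site 3, Summable (fun y => m y * G (z - y)) := fun z =>
    tight_summable_mul hm hG0 (tight_G_le hα3 hup) z
  -- the far-field parameter `K`
  obtain ⟨K, hK⟩ := exists_nat_ge (27 * max C₁ 0 / (6 * c₁) + 2)
  have hdiv : 0 ≤ 27 * max C₁ 0 / (6 * c₁) := by positivity
  have hK2r : (2 : ℝ) ≤ K := by linarith
  have hK2 : 2 ≤ K := by exact_mod_cast hK2r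
  have hKpos : 0 < K := by omega
  have hK1 : (1 : ℝ) ≤ (K : ℝ) - 1 := by linarith
  have hfarc : 27 * max C₁ 0 * ((K : ℝ) - 1) ^ (α - 3) ≤ 6 * c₁ := by
    have h1 : ((K : ℝ) - 1) ^ (α - 3) ≤ ((K : ℝ) - 1) ^ (-1 : ℝ) :=
      Real.rpow_le_rpow_of_exponent_le hK1 (by linarith)
    rw [Real.rpow_neg_one] at h1
    have h2 : 27 * max C₁ 0 ≤ 6 * c₁ * ((K : ℝ) - 1) := by
      have : 27 * max C₁ 0 / (6 * c₁) ≤ (K : ℝ) - 1 := by linarith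
      rw [div_le_iff₀ (by positivity)] at this
      linarith
    calc 27 * max C₁ 0 * ((K : ℝ) - 1) ^ (α - 3) ≤ 27 * max C₁ 0 * ((K : ℝ) - 1)⁻¹ :=
          mul_le_mul_of_nonneg_left h1 (by positivity)
      _ = 27 * max C₁ 0 / ((K : ℝ) - 1) := by rw [div_eq_mul_inv]
      _ ≤ 6 * c₁ := by rw [div_le_iff₀ (by linarith)]; linarith
  refine ⟨(2 * (K : ℝ)) ^ α / c₁, K * (2 * R₀ + 1), by positivity, ?_, ?_⟩
  · exact le_trans (by omega : 1 ≤ 2 * R₀ + 1) (Nat.le_mul_of_pos_left _ hKpos)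
  intro R hR T hT
  -- the auxiliary radius `ρ = ⌊R / K⌋`
  obtain ⟨ρ, hρdef⟩ : ∃ ρ : ℕ, ρ = R / K := ⟨_, rfl⟩
  have hρ₀ρ : 2 * R₀ + 1 ≤ ρ := by
    rw [hρdef]
    exact (Nat.le_div_iff_mul_le hKpos).2 (by rw [mul_comm]; exact hR)
  have hρ1 : 1 ≤ ρ := le_trans (by omega) hρ₀ρ
  have hρpos : (0 : ℝ) < ρ := by exact_mod_cast hρ1
  have hKρR : K * ρ ≤ R := by rw [hρdef]; exact Nat.mul_div_le R K
  have hRlt : R < K * (ρ + 1) := by rw [hρdef]; exact Nat.lt_mul_div_succ R hKpos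
  have hR2Kρ : (R : ℝ) ≤ 2 * K * ρ := by
    have h1 : (R : ℝ) ≤ K * (ρ + 1) := by exact_mod_cast hRlt.le
    have h2 : (K : ℝ) ≤ K * ρ := by
      have : (1 : ℝ) ≤ ρ := by exact_mod_cast hρ1
      nlinarith
    linarith
  have hKρR' : (K : ℝ) * ρ ≤ R := by exact_mod_cast hKρR
  have hR1 : (1 : ℝ) ≤ R := by
    exact_mod_cast le_trans (le_trans hρ1 (Nat.le_mul_of_pos_left ρ hKpos)) hKρR
  -- on `T`: `‖y‖ ≥ Kρ` and `m(y) ≥ 0`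
  have hTy : ∀ y ∈ T, (K : ℝ) * ρ ≤ ‖y‖ ∧ 0 ≤ m y := by
    intro y hy
    have h1 := hT y hy
    exact ⟨by linarith, hnn y (norm_pos_iff.1 (by linarith))⟩
  -- the gap `F_ρ(0) - F_ρ(-y) ≥ c₁ ρ^α` on `T`
  have hlow := tight_lower hG0 hα3 hc₁.le hlo hρ₀ρ
  have hdiff : ∀ y ∈ T, c₁ * (ρ : ℝ) ^ α ≤ ∑ z ∈ box 3 ρ, G z - ∑ z ∈ box 3 ρ, G (z - y) := by
    intro y hy
    have hfar := tight_far hα3 hC₁'0 hup' hρ1 hK2 (hTy y hy).1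
    have hρα : 0 ≤ (ρ : ℝ) ^ α := Real.rpow_nonneg hρpos.le _
    have : 27 * max C₁ 0 * ((K : ℝ) - 1) ^ (α - 3) * (ρ : ℝ) ^ α ≤ 6 * c₁ * (ρ : ℝ) ^ α :=
      mul_le_mul_of_nonneg_right hfarc hρα
    linarith
  -- the flux bound
  have hflux := tight_flux hm hzero hnn hconv hcap hsm ρ T
  have hsumT : 0 ≤ ∑ y ∈ T, m y := Finset.sum_nonneg fun y hy => (hTy y hy).2
  have hkey : c₁ * (ρ : ℝ) ^ α * ∑ y ∈ T, m y ≤ 1 := by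
    calc c₁ * (ρ : ℝ) ^ α * ∑ y ∈ T, m y = ∑ y ∈ T, m y * (c₁ * (ρ : ℝ) ^ α) := by
          rw [Finset.mul_sum]
          exact Finset.sum_congr rfl fun y _ => mul_comm _ _
      _ ≤ ∑ y ∈ T, m y * (∑ z ∈ box 3 ρ, G z - ∑ z ∈ box 3 ρ, G (z - y)) :=
          Finset.sum_le_sum fun y hy => mul_le_mul_of_nonneg_left (hdiff y hy) (hTy y hy).2
      _ ≤ 1 := hflux
  -- conclusion: `R^α ≤ (2K)^α ρ^α`
  have hρα : 0 < (ρ : ℝ) ^ α := Real.rpow_pos_of_pos hρpos _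
  have hRα : (R : ℝ) ^ α ≤ (2 * (K : ℝ)) ^ α * (ρ : ℝ) ^ α := by
    rw [← Real.mul_rpow (by positivity) hρpos.le]
    exact Real.rpow_le_rpow (by positivity) (by linarith) hα0
  calc (R : ℝ) ^ α * ∑ y ∈ T, m y ≤ (2 * (K : ℝ)) ^ α * (ρ : ℝ) ^ α * ∑ y ∈ T, m y :=
        mul_le_mul_of_nonneg_right hRα hsumT
    _ = (2 * (K : ℝ)) ^ α / c₁ * (c₁ * (ρ : ℝ) ^ α * ∑ y ∈ T, m y) := by
        field_simp
    _ ≤ (2 * (K : ℝ)) ^ α / c₁ * 1 := mul_le_mul_of_nonneg_left hkey (by positivity)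
    _ = (2 * (K : ℝ)) ^ α / c₁ := mul_one _

/-! ### The one-dimensional power sum -/

/-- Bernoulli step for the telescoping bound: `(2−α)(s+1)^{1−α} ≤ (s+1)^{2−α} − s^{2−α}` for
`s ≥ 0`, `1 ≤ α < 2` (Bernoulli's inequality `(1 − u⁻¹)^{2−α} ≤ 1 − (2−α)u⁻¹`, `u = s + 1`).
[folklore] -/
theorem tight_rpow_step {α : ℝ} (hα1 : 1 ≤ α) (hα2 : α < 2) {s : ℝ} (hs : 0 ≤ s) :
    (2 - α) * (s + 1) ^ (1 - α) ≤ (s + 1) ^ (2 - α) - s ^ (2 - α) := by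
  have hu : 0 < s + 1 := by linarith
  have hinv : (s + 1)⁻¹ ≤ 1 := inv_le_one_of_one_le₀ (by linarith)
  have hB := rpow_one_add_le_one_add_mul_self (s := -(s + 1)⁻¹) (p := 2 - α)
    (by linarith) (by linarith) (by linarith)
  have hup : 0 < (s + 1) ^ (2 - α) := Real.rpow_pos_of_pos hu _
  have h1 : (1 + -(s + 1)⁻¹) ^ (2 - α) * (s + 1) ^ (2 - α) = s ^ (2 - α) := by
    have h0 : 0 ≤ 1 + -(s + 1)⁻¹ := by linarith
    rw [← Real.mul_rpow h0 hu.le]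
    congr 1
    field_simp
    ring
  have h2 : (1 + (2 - α) * -(s + 1)⁻¹) * (s + 1) ^ (2 - α) =
      (s + 1) ^ (2 - α) - (2 - α) * (s + 1) ^ (1 - α) := by
    have : (s + 1) ^ (1 - α) = (s + 1) ^ (2 - α) / (s + 1) := by
      rw [show (1 - α) = (2 - α) - 1 by ring, Real.rpow_sub_one hu.ne']
    rw [this]
    field_simp
    ring
  have h3 := mul_le_mul_of_nonneg_right hB hup.le
  rw [h1, h2] at h3
  linarith

/-- The one-dimensional power sum: `Σ_{t=−R}^{R} |t|^{1−α} ≤ 2R^{2−α}/(2−α)` for `1 ≤ α < 2`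
(telescoping with `tight_rpow_step`; the term `t = 0` vanishes as `α > 1`). [folklore] -/
theorem tight_sum_Icc_abs_rpow {α : ℝ} (hα1 : 1 < α) (hα2 : α < 2) (R : ℕ) :
    ∑ t ∈ Finset.Icc (-(R : ℤ)) R, |(t : ℝ)| ^ (1 - α) ≤ 2 * (R : ℝ) ^ (2 - α) / (2 - α) := by
  have h2α : 0 < 2 - α := by linarith
  induction R with
  | zero =>
    have h0 : ∑ t ∈ Finset.Icc (-((0 : ℕ) : ℤ)) ((0 : ℕ) : ℤ), |(t : ℝ)| ^ (1 - α) = 0 := by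
      simp only [Nat.cast_zero, neg_zero, Finset.Icc_self, Finset.sum_singleton, Int.cast_zero,
        abs_zero]
      exact Real.zero_rpow (sub_neg.2 hα1).ne
    rw [h0, Nat.cast_zero, Real.zero_rpow h2α.ne']
    simp
  | succ R ih =>
    have hstep := tight_rpow_step hα1.le hα2 (Nat.cast_nonneg R)
    have hIcc : Finset.Icc (-((R + 1 : ℕ) : ℤ)) ((R + 1 : ℕ) : ℤ) =
        insert (-((R : ℤ) + 1)) (insert ((R : ℤ) + 1) (Finset.Icc (-(R : ℤ)) R)) := by
      ext t
      simp only [Finset.mem_Icc, Finset.mem_insert, Nat.cast_add, Nat.cast_one]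
      omega
    have hn1 : -((R : ℤ) + 1) ∉ insert ((R : ℤ) + 1) (Finset.Icc (-(R : ℤ)) R) := by
      simp only [Finset.mem_insert, Finset.mem_Icc]; omega
    have hn2 : (R : ℤ) + 1 ∉ Finset.Icc (-(R : ℤ)) R := by
      simp only [Finset.mem_Icc]; omega
    rw [hIcc, Finset.sum_insert hn1, Finset.sum_insert hn2]
    have hpos : (0 : ℝ) ≤ (R : ℝ) + 1 := by positivity
    push_cast
    rw [abs_neg, abs_of_nonneg hpos]
    rw [le_div_iff₀ h2α] at ih ⊢
    linarith

/-- **Registered sub-goal `stub_tightness_auxAtInfinity`** (tightness at infinity, = `tight_atInfinity`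
with explicit binders): under the flux hypotheses, `G ≥ 0`, `0 ≤ α ≤ 2`, `c₁ > 0` and the two scale
bounds, `R^α Σ_{y ∈ T} m(y) ≤ C` for all `R ≥ R₁` and all finite `T ⊆ {‖y‖ ≥ R}`. [folklore] -/
theorem stub_tightness_auxAtInfinity :
    ∀ (m G : Site 3 → ℝ) (α c₁ C₁ : ℝ) (R₀ : ℕ), Summable m → (∑' y, m y) = 0 → (∀ y, y ≠ 0 →
      0 ≤ m y) → (∀ z : Site 3, (∑' y, m y * G (z - y)) = if z = 0 then -1 else 0) →
      (∀ (R : ℕ) (v : Site 3), ∑ z ∈ box 3 R, G (z + v) ≤ ∑ z ∈ box 3 R, G z) → (∀ x, 0 ≤ G x) →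
      0 ≤ α → α ≤ 2 → 0 < c₁ → (∀ x : Site 3, x ≠ 0 → G x ≤ C₁ * ‖x‖ ^ (α - 3)) →
      (∀ x : Site 3, (R₀ : ℝ) ≤ ‖x‖ → c₁ * ‖x‖ ^ (α - 3) ≤ G x) →
      ∃ (C : ℝ) (R₁ : ℕ), 0 ≤ C ∧ 1 ≤ R₁ ∧ ∀ R : ℕ, R₁ ≤ R →
      ∀ T : Finset (Site 3), (∀ y ∈ T, (R : ℝ) ≤ ‖y‖) → (R : ℝ) ^ α * ∑ y ∈ T, m y ≤ C :=
  fun _ _ _ _ _ _ hm hzero hnn hconv hcap hG0 hα0 hα2 hc₁ hup hlo =>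
    tight_atInfinity hm hzero hnn hconv hcap hG0 hα0 hα2 hc₁ hup hlo

end Summit.CriticalPhenomena.Ising3DConformalLimit.Cruxes.DirectCorrelationStableTail.DiffusiveBranchIsNonsaturation

end
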